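import Literature.AlgebraicGeometry.Frobenioids.PadicFrobenioidTwistToolkit
import HarnessLib

/-!
# Frobenioids II, Remark 1.2.2, sentence 3 under reading (R1): `u_D · τ` is a characteristic splitting (proof)

Mochizuki, *The geometry of Frobenioids II*, Kyushu J. Math. **62** (2008), §1, Remark 1.2.2, p. 10
[cite: MochizukiFrdII2008, Rmk 1.2.2 p.10]: "Then if `τ` is a characteristic splitting on `C`, then it
follows immediately that `u_D` determines a new characteristic splitting `u_D · τ`, by taking
`(u_D · τ)(A_D) := (u_{A_D} · η)^{ℤ_{≥0}} ⊆ O^▷(A_D)` for `η ∈ τ(A_D)` a generator of `τ(A_D)`."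

PROOF-ONLY companion (abc-iut node `FrdII:Rmk1.2.2-R1`): discharge of abc-iut-L1-t4's
`Datum.Rmk122TwistOfBijective` (`PadicFrobenioidRmk122.lean`; reading (R1) = bijective pull-backs on `Φ`,
the tacit constancy hypothesis of FINDING T4g2-F1). For every object `X` over `A`: `τ(X)` has a unique
generator `η_X` (`Div(η_X)` generates `Φ(A) ≅ ℤ_{≥0}`), `(u_D · τ)(X) = (η_X · w_X)^{ℤ_{≥0}}` with
`w_X = (1, id, 0, u_A)`; [FrdI] Def. 2.3: (a) `(u_D · τ)(X) → O^▷(X)^char` is bijective (`Div((η w)^k) =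
Div(η)^k`); subfunctoriality on linear `φ : X → Y`: `O^▷(φ)(η_Y)` lies in `τ(X)` and its divisor
`Φ(Base φ)(Div η_Y)` is again a generator BECAUSE `Φ(Base φ)` is bijective, so `O^▷(φ)(η_Y) = η_X`, while
`O^▷(φ)(w_Y) = w_X` (`u_D` is a section); (b) isotropic hulls: `O^▷(φ)` is defined on all of `O^▷(Y)`.
-/

namespace Literature.AlgebraicGeometry.Frobenioids

namespace PadicFrd

open CategoryTheory Opposite Function

universe v u

namespace Datum

variable {D : Type u} [Category.{v} D] {p : ℕ} [Fact p.Prime] (d : Datum D p)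

/-- `End.asHom` turns products into composites. [folklore] -/
private theorem asHom_mul'' {X : d.frobenioid} (a b : End X) : End.asHom (a * b) = End.asHom b ≫ End.asHom a :=
  rfl

section Twist

variable (s : d.UnitSection) (T : PreFrobenioid.CharacteristicSplitting d.structureFunctor)

/-- `w_X ∈ O^▷(X)` (as an element of `End X`). [cite: MochizukiFrdII2008, Rmk 1.2.2 p.10] -/
theorem of_unitEnd_mem (X : d.frobenioid) :
    End.of (s.unitEnd X) ∈ PreFrobenioid.endSubmonoid d.structureFunctor X :=
  s.unitEnd_mem X

/-- `(u_D · τ)(X) ⊆ O^▷(X)`. [cite: MochizukiFrdII2008, Rmk 1.2.2 p.10] -/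
theorem twist_le (X : d.frobenioid) : s.twist T.τ X ≤ PreFrobenioid.endSubmonoid d.structureFunctor X :=
  Submonoid.closure_le.mpr (by
    rintro e ⟨η, hη, rfl⟩
    exact Submonoid.mul_mem _ (d.τ_le' T X hη.1) (d.of_unitEnd_mem s X))

/-- **`(u_D · τ)(X) = (η · w_X)^{ℤ_{≥0}}`** for THE generator `η` of `τ(X)` (generators are unique).
[cite: MochizukiFrdII2008, Rmk 1.2.2 p.10] -/
theorem mem_twist_iff (hap : d.IsAbsolutelyPrimitive) {X : d.frobenioid} {η : End X}
    (hη : IsGeneratorOf η (T.τ X)) (t : End X) :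
    t ∈ s.twist T.τ X ↔ ∃ k : ℕ, t = (η * End.of (s.unitEnd X)) ^ k := by
  constructor
  · intro ht
    induction ht using Submonoid.closure_induction with
    | mem e he =>
      obtain ⟨η', hη', rfl⟩ := he
      exact ⟨1, by rw [pow_one, d.isGeneratorOf_unique T hap hη' hη]⟩
    | one => exact ⟨0, (pow_zero _).symm⟩
    | mul x y _ _ ihx ihy =>
      obtain ⟨a, rfl⟩ := ihx
      obtain ⟨b, rfl⟩ := ihy
      exact ⟨a + b, (pow_add _ _ _).symm⟩
  · rintro ⟨k, rfl⟩
    exact Submonoid.pow_mem _ (s.mul_unitEnd_mem_twist T.τ hη) k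

/-- `Div((η · w_X)^k) = Div(η)^k` (`Div(w_X) = 0`). [cite: MochizukiFrdII2008, Rmk 1.2.2 p.10] -/
theorem div_twistGen_pow {X : d.frobenioid} {η : End X} (hη : η ∈ PreFrobenioid.endSubmonoid d.structureFunctor X)
    (k : ℕ) : ModelFrobenioid.div (End.asHom ((η * End.of (s.unitEnd X)) ^ k)) =
      ModelFrobenioid.div (End.asHom η) ^ k := by
  rw [d.div_pow_of_mem (Submonoid.mul_mem _ hη (d.of_unitEnd_mem s X)), asHom_mul'',
    d.div_comp_of_mem hη (d.of_unitEnd_mem s X)]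
  change (ModelFrobenioid.div (End.asHom η) * 1) ^ k = _
  rw [mul_one]

/-- **`O^▷(φ)(w_Y) = w_X`** for a linear `φ : X → Y` (`u_D` is a section: `B(Base φ)(u_{A_Y}) = u_{A_X}`).
[cite: MochizukiFrdII2008, Rmk 1.2.2 p.10] -/
theorem comp_unitEnd_eq {X Y : d.frobenioid} (φ : X ⟶ Y) (hφ : PreFrobenioid.IsLinear d.structureFunctor φ) :
    φ ≫ End.asHom (End.of (s.unitEnd Y)) = End.asHom (End.of (s.unitEnd X)) ≫ φ := by
  obtain ⟨α, hαm, hαc, hαu, -⟩ := d.exists_endo_comp_eq φ hφ (d.of_unitEnd_mem s Y)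
  have hα : α = End.of (s.unitEnd X) :=
    d.eq_of_mem_of_unit_eq hαm (d.of_unitEnd_mem s X) (by rw [hαu]; exact s.map_u (ModelFrobenioid.baseMap φ))
  rw [hαc, hα]

/-- **Subfunctoriality transports generators** (the use of bijective pull-backs): for a linear `φ : X → Y`
and a generator `η` of `τ(Y)`, the endomorphism `O^▷(φ)(η) ∈ τ(X)` is a generator of `τ(X)` — its divisor
`Φ(Base φ)(Div η)` generates `Φ(A_X)` because `Φ(Base φ)` is bijective. [cite: MochizukiFrdII2008, Rmk 1.2.2 p.10] -/
theorem isGeneratorOf_of_comp_eq (hbij : d.HasBijectivePullbacks) (hap : d.IsAbsolutelyPrimitive)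
    {X Y : d.frobenioid} (φ : X ⟶ Y)
    {η : End Y} (hη : IsGeneratorOf η (T.τ Y)) {α : End X} (hατ : α ∈ T.τ X)
    (hαd : ModelFrobenioid.div (End.asHom α) =
      (d.Φ.map (ModelFrobenioid.baseMap φ).op).hom (ModelFrobenioid.div (End.asHom η))) :
    IsGeneratorOf α (T.τ X) := by
  obtain ⟨hgen, -⟩ := d.div_isGenerator_of_isGeneratorOf T hap hη
  have hgenX : ∀ x : d.Φ.obj (op X.base), ∃ k : ℕ, x = ModelFrobenioid.div (End.asHom α) ^ k := fun x => by
    obtain ⟨y, rfl⟩ := (hbij (ModelFrobenioid.baseMap φ)).2 x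
    obtain ⟨k, rfl⟩ := hgen y
    exact ⟨k, by rw [hαd, map_pow]⟩
  refine ⟨hατ, fun t ht => ?_⟩
  obtain ⟨k, hk⟩ := hgenX (ModelFrobenioid.div (End.asHom t))
  exact ⟨k, d.eq_of_mem_τ_of_div_eq T ht (Submonoid.pow_mem _ hατ k)
    (by rw [d.div_pow_of_mem (d.τ_le' T X hατ), hk])⟩

/-- **[FrdI] Def. 2.3, subfunctoriality, for `u_D · τ`**: for a linear `φ : X → Y`, `β ∈ (u_D · τ)(Y)` and
`α ∈ O^▷(X)` with `β ∘ φ = φ ∘ α`, `α ∈ (u_D · τ)(X)`. [cite: MochizukiFrdII2008, Rmk 1.2.2 p.10] -/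
theorem twist_res_mem (hbij : d.HasBijectivePullbacks) (hap : d.IsAbsolutelyPrimitive)
    {X Y : d.frobenioid} (φ : X ⟶ Y) (hφ : PreFrobenioid.IsLinear d.structureFunctor φ)
    {β : End Y} (hβ : β ∈ s.twist T.τ Y)
    {α : End X} (hα : α ∈ PreFrobenioid.endSubmonoid d.structureFunctor X)
    (h : φ ≫ End.asHom β = End.asHom α ≫ φ) : α ∈ s.twist T.τ X := by
  induction hβ using Submonoid.closure_induction generalizing α with
  | mem e he =>
    obtain ⟨η, hη, rfl⟩ := he
    obtain ⟨α₀, hα₀m, hα₀c, -, hα₀d⟩ := d.exists_endo_comp_eq φ hφ (d.τ_le' T Y hη.1)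
    have hα₀τ : α₀ ∈ T.τ X :=
      T.res_mem (d.thm12_isIsotropic X) (d.thm12_isIsotropic Y) φ hφ η hη.1 α₀ hα₀m hα₀c
    have hgen := d.isGeneratorOf_of_comp_eq T hbij hap φ hη hα₀τ hα₀d
    have hc := d.comp_mul_eq φ hα₀c (d.comp_unitEnd_eq s φ hφ)
    have hαeq : α = α₀ * End.of (s.unitEnd X) :=
      d.endo_eq_of_comp_eq φ hφ (Submonoid.mul_mem _ (d.τ_le' T Y hη.1) (d.of_unitEnd_mem s Y)) hα
        (Submonoid.mul_mem _ hα₀m (d.of_unitEnd_mem s X)) h hc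
    rw [hαeq]
    exact s.mul_unitEnd_mem_twist T.τ hgen
  | one =>
    have h1 : φ ≫ End.asHom (1 : End Y) = End.asHom (1 : End X) ≫ φ := by
      change φ ≫ 𝟙 Y = 𝟙 X ≫ φ
      rw [Category.comp_id, Category.id_comp]
    rw [d.endo_eq_of_comp_eq φ hφ (Submonoid.one_mem _) hα (Submonoid.one_mem _) h h1]
    exact Submonoid.one_mem _
  | mul x y hx hy ihx ihy =>
    obtain ⟨αx, hαxm, hαxc, -, -⟩ := d.exists_endo_comp_eq φ hφ (d.twist_le s T Y hx)
    obtain ⟨αy, hαym, hαyc, -, -⟩ := d.exists_endo_comp_eq φ hφ (d.twist_le s T Y hy)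
    have hc := d.comp_mul_eq φ hαxc hαyc
    rw [d.endo_eq_of_comp_eq φ hφ (Submonoid.mul_mem _ (d.twist_le s T Y hx) (d.twist_le s T Y hy)) hα
      (Submonoid.mul_mem _ hαxm hαym) h hc]
    exact Submonoid.mul_mem _ (ihx hαxm hαxc) (ihy hαym hαyc)

/-- **[FrdI] Def. 2.3 (a) for `u_D · τ`**: `(u_D · τ)(X) → O^▷(X)^char` is bijective.
[cite: MochizukiFrdII2008, Rmk 1.2.2 p.10] -/
theorem twist_bijective (hap : d.IsAbsolutelyPrimitive) (X : d.frobenioid) :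
    Bijective fun t : s.twist T.τ X =>
      Associates.mk (⟨t.1, d.twist_le s T X t.2⟩ : PreFrobenioid.endSubmonoid d.structureFunctor X) := by
  obtain ⟨η, hη⟩ := d.exists_isGeneratorOf_τ T hap X
  obtain ⟨hgen, hginj⟩ := d.div_isGenerator_of_isGeneratorOf T hap hη
  have hηm := d.τ_le' T X hη.1
  constructor
  · rintro ⟨t, ht⟩ ⟨t', ht'⟩ h
    obtain ⟨a, rfl⟩ := (d.mem_twist_iff s T hap hη t).mp ht
    obtain ⟨b, rfl⟩ := (d.mem_twist_iff s T hap hη t').mp ht'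
    have hd := d.div_eq_of_associated (d.twist_le s T X ht) (d.twist_le s T X ht')
      (Associates.mk_eq_mk_iff_associated.mp h)
    rw [d.div_twistGen_pow s hηm, d.div_twistGen_pow s hηm] at hd
    apply Subtype.ext
    change (η * End.of (s.unitEnd X)) ^ a = (η * End.of (s.unitEnd X)) ^ b
    rw [hginj a b hd]
  · intro q
    obtain ⟨e, rfl⟩ := Associates.mk_surjective q
    obtain ⟨k, hk⟩ := hgen (ModelFrobenioid.div (End.asHom (e : End X)))
    have hmem : (η * End.of (s.unitEnd X)) ^ k ∈ s.twist T.τ X := (d.mem_twist_iff s T hap hη _).mpr ⟨k, rfl⟩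
    refine ⟨⟨_, hmem⟩, Associates.mk_eq_mk_iff_associated.mpr ?_⟩
    exact d.associated_of_div_eq (d.twist_le s T X hmem) e.2 (by rw [d.div_twistGen_pow s hηm, hk])

/-- **[FrdI] Def. 2.3 (b) for `u_D · τ`** (indeed for every linear `φ : X → Y`): every `β ∈ (u_D · τ)(Y)` is
`O^▷(φ)` of some `α ∈ O^▷(X)`. [cite: MochizukiFrdII2008, Rmk 1.2.2 p.10] -/
theorem twist_hull {X Y : d.frobenioid} (φ : X ⟶ Y) (hφ : PreFrobenioid.IsLinear d.structureFunctor φ)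
    {β : End Y} (hβ : β ∈ s.twist T.τ Y) :
    ∃ α ∈ PreFrobenioid.endSubmonoid d.structureFunctor X, φ ≫ End.asHom β = End.asHom α ≫ φ := by
  obtain ⟨α, hαm, hαc, -, -⟩ := d.exists_endo_comp_eq φ hφ (d.twist_le s T Y hβ)
  exact ⟨α, hαm, hαc⟩

end Twist

/-- **Remark 1.2.2, sentence 3 under reading (R1) — PROVED**: for an absolutely primitive datum whose
pull-back maps on `Φ` are bijective, every section `u_D` of `O^×(−)` and every characteristic splitting `τ` on
`C` give a characteristic splitting `u_D · τ` ([FrdI] Def. 2.3 as typed by abc-iut-L1-t2), with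
`(u_D · τ)(X) = (η_X · w_X)^{ℤ_{≥0}}`. (Without bijective pull-backs the subfunctoriality fails: FINDING
T4g2-F1, abc-iut-L1-t4.) [cite: MochizukiFrdII2008, Rmk 1.2.2 p.10] -/
theorem rmk122TwistOfBijective_holds : d.Rmk122TwistOfBijective := by
  intro hbij hap s T
  exact ⟨{ τ := s.twist T.τ
           τ_le := fun {X} _ => d.twist_le s T X
           res_mem := fun {X Y} _ _ φ hφ β hβ α hα h => d.twist_res_mem s T hbij hap φ hφ hβ hα h
           bijective := fun {X} _ => d.twist_bijective s T hap X
           hull := fun {X Y} φ hφ β hβ => d.twist_hull s T φ hφ.2.1.1 hβ }, rfl⟩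

end Datum

end PadicFrd

end Literature.AlgebraicGeometry.Frobenioids
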